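import Literature.ModelTheory.PseudofiniteFields.DefinableSetsFiniteFields
import Mathlib.RingTheory.FreeCommRing
import Mathlib.ModelTheory.Complexity
import HarnessLib

/-!
# Toolkit for counting definable sets over finite fields

Small, self-contained tools for the programme around the named fact
`Literature.ModelTheory.PseudofiniteFields.ChatzidakisVanDenDriesMacintyre1992_mainTheorem`
(Z. Chatzidakis, L. van den Dries, A. Macintyre, *Definable sets over finite fields*, J. reine
angew. Math. **427** (1992) 107–135), kept OUT of the sibling proof file
`DefinableSetsFiniteFieldsProofs.lean` (which formalizes §3 of the paper bottom-up) so that both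
can grow independently; this file imports only `DefinableSetsFiniteFields.lean`.

## What is here (sorry-free; theorems only, no definitions, no named facts)

* Elementary API of the point count `definableCard K φ c = |φ(K^m; c)|`:
  `definableCard_congr_realize` (formulas with the same realizations have the same count),
  `definableCard_bot`, `definableCard_top`, `definableCard_mono`,
  `definableCard_sup_add_definableCard_inf` (inclusion–exclusion),
  `definableCard_sup_of_disjoint`, `definableCard_not_add` (complements),
  `definableCard_iSup_le` and `definableCard_iSup_of_pairwise_disjoint` (a finite disjunction
  `Formula.iSup` of pairwise disjoint definable sets is counted by the sum — the bookkeeping of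
  disjoint disjuncts, CDM p. 123 (3) / Kowalski 2007 Thm. 8 (1)–(2)). [folklore]
* Ring terms are integer polynomials, uniformly in the ring: `map_realize_term` (realization of
  ring terms commutes with ring homomorphisms of compatible rings), `realize_term_eq_lift`,
  `realize_term_eq_aeval` (`t(v) = P_t(v)` for the FIXED integer polynomial
  `P_t := freeCommRingEquivMvPolynomialInt α (t(FreeCommRing.of)) ∈ ℤ[α]`, in every commutative
  compatible ring), `realize_bdEqual_iff_aeval_sub_eq_zero` (atoms are integer polynomial
  equations) and `exists_mvPolynomial_boolean_of_isQF` (a quantifier-free ring formula is,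
  uniformly in all commutative rings, a Boolean combination of finitely many INTEGER polynomial
  equations `P_j(v) = 0`, `P_j ∈ ℤ[vars]`). Mathlib has the converse direction
  `FirstOrder.Ring.termOfFreeCommRing`. This is the form in which polynomials "over `ℤ` in the
  variables `X, Y` (and `T`)" enter CDM's statements (1.11), (2.4), (2.7), (3.4) and the normal
  form (3) of p. 123 (families of algebraic sets `V_x = V(f(x, Y))`, `f ∈ ℤ[X, Y]^r`), complementing
  the field-by-field, degree-bounded form `exists_mvPolynomial_of_term` of the proof file.
  [folklore]

## References

* [ChatzidakisVanDenDriesMacintyre1992] Z. Chatzidakis, L. van den Dries, A. Macintyre, Definable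
  sets over finite fields, J. reine angew. Math. 427 (1992) 107–135, (1.11), (3.4), p. 123 (3).
* [Kowalski2007] E. Kowalski, Exponential sums over definable subsets of finite fields, Israel J.
  Math. 160 (2007) 219–251, Thm. 8 (arXiv:math/0504316).
-/

namespace Literature.ModelTheory.PseudofiniteFields

open FirstOrder FirstOrder.Language FirstOrder.Ring

/-! ### Elementary API of the point count `definableCard` -/

section API

variable (K : Type*) [Add K] [Mul K] [Neg K] [One K] [Zero K] {m n n' : ℕ}

/-- Formulas with the same realizations (for the given parameters) have the same number of points.
[folklore] -/
theorem definableCard_congr_realize (φ : Language.ring.Formula (Fin m ⊕ Fin n))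
    (ψ : Language.ring.Formula (Fin m ⊕ Fin n')) (c : Fin n → K) (c' : Fin n' → K)
    (h : letI := compatibleRingOfRing K;
      ∀ x : Fin m → K, φ.Realize (Sum.elim x c) ↔ ψ.Realize (Sum.elim x c')) :
    definableCard K φ c = definableCard K ψ c' := by
  letI := compatibleRingOfRing K
  rw [definableCard_def, definableCard_def]
  exact Nat.card_congr (Equiv.subtypeEquivRight h)

/-- The contradictory formula defines the empty set. [folklore] -/
theorem definableCard_bot (c : Fin n → K) :
    definableCard K (⊥ : Language.ring.Formula (Fin m ⊕ Fin n)) c = 0 := by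
  letI := compatibleRingOfRing K
  rw [definableCard_def]
  haveI : IsEmpty {x : Fin m → K // (⊥ : Language.ring.Formula (Fin m ⊕ Fin n)).Realize
      (Sum.elim x c)} := ⟨fun x => (Formula.realize_bot.1 x.2).elim⟩
  exact Nat.card_of_isEmpty

variable [Fintype K]

/-- The tautological formula defines all of `K^m`. [folklore] -/
theorem definableCard_top (c : Fin n → K) :
    definableCard K (⊤ : Language.ring.Formula (Fin m ⊕ Fin n)) c = Fintype.card K ^ m := by
  classical
  rw [definableCard_eq_card_filter]
  letI := compatibleRingOfRing K
  rw [Finset.filter_true_of_mem fun x _ => Formula.realize_top.2 trivial, Finset.card_univ,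
    Fintype.card_fun, Fintype.card_fin]

/-- Monotonicity: if `φ(x̄, c) → ψ(x̄, c')` for all `x̄ ∈ K^m` then `|φ(K^m; c)| ≤ |ψ(K^m; c')|`.
[folklore] -/
theorem definableCard_mono (φ : Language.ring.Formula (Fin m ⊕ Fin n))
    (ψ : Language.ring.Formula (Fin m ⊕ Fin n')) (c : Fin n → K) (c' : Fin n' → K)
    (h : letI := compatibleRingOfRing K;
      ∀ x : Fin m → K, φ.Realize (Sum.elim x c) → ψ.Realize (Sum.elim x c')) :
    definableCard K φ c ≤ definableCard K ψ c' := by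
  classical
  rw [definableCard_eq_card_filter, definableCard_eq_card_filter]
  letI := compatibleRingOfRing K
  exact Finset.card_le_card fun x hx => by
    simp only [Finset.mem_filter, Finset.mem_univ, true_and] at hx ⊢
    exact h x hx

/-- Inclusion–exclusion for two formulas: `|φ ∨ ψ| + |φ ∧ ψ| = |φ| + |ψ|`. [folklore] -/
theorem definableCard_sup_add_definableCard_inf (φ ψ : Language.ring.Formula (Fin m ⊕ Fin n))
    (c : Fin n → K) :
    definableCard K (φ ⊔ ψ) c + definableCard K (φ ⊓ ψ) c =
      definableCard K φ c + definableCard K ψ c := by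
  classical
  simp only [definableCard_eq_card_filter]
  letI := compatibleRingOfRing K
  have hsup : (Finset.univ.filter fun x : Fin m → K => (φ ⊔ ψ).Realize (Sum.elim x c)) =
      (Finset.univ.filter fun x : Fin m → K => φ.Realize (Sum.elim x c)) ∪
        (Finset.univ.filter fun x : Fin m → K => ψ.Realize (Sum.elim x c)) := by
    ext x; simp [Formula.realize_sup]
  have hinf : (Finset.univ.filter fun x : Fin m → K => (φ ⊓ ψ).Realize (Sum.elim x c)) =
      (Finset.univ.filter fun x : Fin m → K => φ.Realize (Sum.elim x c)) ∩
        (Finset.univ.filter fun x : Fin m → K => ψ.Realize (Sum.elim x c)) := by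
    ext x; simp [Formula.realize_inf]
  rw [hsup, hinf, Finset.card_union_add_card_inter]

/-- Additivity on disjoint sets: if `φ(K^m; c) ∩ ψ(K^m; c) = ∅` then `|φ ∨ ψ| = |φ| + |ψ|`.
[folklore] -/
theorem definableCard_sup_of_disjoint (φ ψ : Language.ring.Formula (Fin m ⊕ Fin n))
    (c : Fin n → K)
    (h : letI := compatibleRingOfRing K;
      ∀ x : Fin m → K, ¬(φ.Realize (Sum.elim x c) ∧ ψ.Realize (Sum.elim x c))) :
    definableCard K (φ ⊔ ψ) c = definableCard K φ c + definableCard K ψ c := by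
  have h0 : definableCard K (φ ⊓ ψ) c = 0 := by
    refine (definableCard_congr_realize K (φ ⊓ ψ) (⊥ : Language.ring.Formula (Fin m ⊕ Fin n))
      c c fun x => ?_).trans (definableCard_bot K c)
    letI := compatibleRingOfRing K
    simp only [Formula.realize_inf, Formula.realize_bot, iff_false]
    exact h x
  have := definableCard_sup_add_definableCard_inf K φ ψ c
  rw [h0, add_zero] at this
  exact this

/-- Complements: `|¬φ| + |φ| = q^m`. [folklore] -/
theorem definableCard_not_add (φ : Language.ring.Formula (Fin m ⊕ Fin n)) (c : Fin n → K) :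
    definableCard K φ.not c + definableCard K φ c = Fintype.card K ^ m := by
  classical
  simp only [definableCard_eq_card_filter]
  letI := compatibleRingOfRing K
  have hnot : (Finset.univ.filter fun x : Fin m → K => φ.not.Realize (Sum.elim x c)) =
      (Finset.univ.filter fun x : Fin m → K => ¬φ.Realize (Sum.elim x c)) := by
    ext x; simp [Formula.realize_not]
  rw [hnot, add_comm, Finset.card_filter_add_card_filter_not, Finset.card_univ,
    Fintype.card_fun, Fintype.card_fin]

/-- Subadditivity over a finite disjunction: `|⋁ᵢ ψᵢ| ≤ Σᵢ |ψᵢ|`. [folklore] -/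
theorem definableCard_iSup_le {ι : Type*} [Fintype ι]
    (ψ : ι → Language.ring.Formula (Fin m ⊕ Fin n)) (c : Fin n → K) :
    definableCard K (Formula.iSup ψ) c ≤ ∑ i, definableCard K (ψ i) c := by
  classical
  simp only [definableCard_eq_card_filter]
  letI := compatibleRingOfRing K
  have hsup : (Finset.univ.filter fun x : Fin m → K => (Formula.iSup ψ).Realize (Sum.elim x c)) =
      Finset.univ.biUnion fun i =>
        (Finset.univ.filter fun x : Fin m → K => (ψ i).Realize (Sum.elim x c)) := by
    ext x; simp [Formula.realize_iSup]
  rw [hsup]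
  exact Finset.card_biUnion_le

/-- Additivity over a finite disjunction of pairwise disjoint definable sets:
`|⋁ᵢ ψᵢ| = Σᵢ |ψᵢ|` when no point satisfies two of the `ψᵢ`. This is the bookkeeping step
"`|φ(F_q, y)| = Σ_κ |Φ_κ(F_q, x', y)|`, the `Φ_κ` being disjoint" of the CDM decomposition
(Kowalski 2007, Thm. 8 (1)–(2)). [cite: Kowalski2007, Thm. 8] -/
theorem definableCard_iSup_of_pairwise_disjoint {ι : Type*} [Fintype ι]
    (ψ : ι → Language.ring.Formula (Fin m ⊕ Fin n)) (c : Fin n → K)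
    (h : letI := compatibleRingOfRing K;
      ∀ x : Fin m → K, ∀ i j, (ψ i).Realize (Sum.elim x c) → (ψ j).Realize (Sum.elim x c) →
        i = j) :
    definableCard K (Formula.iSup ψ) c = ∑ i, definableCard K (ψ i) c := by
  classical
  simp only [definableCard_eq_card_filter]
  letI := compatibleRingOfRing K
  have hsup : (Finset.univ.filter fun x : Fin m → K => (Formula.iSup ψ).Realize (Sum.elim x c)) =
      Finset.univ.biUnion fun i =>
        (Finset.univ.filter fun x : Fin m → K => (ψ i).Realize (Sum.elim x c)) := by
    ext x; simp [Formula.realize_iSup]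
  rw [hsup, Finset.card_biUnion]
  intro i _ j _ hij
  refine Finset.disjoint_filter.2 fun x _ hi hj => hij (h x i j hi hj)

end API

/-! ### Ring terms are integer polynomials; quantifier-free formulas are Boolean combinations
of integer polynomial equations -/

section TermsArePolynomials

open FirstOrder.Ring MvPolynomial

variable {α : Type*}

/-- Realization of ring terms commutes with ring homomorphisms between compatible rings:
`f (t(v)) = t(f ∘ v)`. [folklore] -/
theorem map_realize_term {R S : Type*} [NonAssocRing R] [CompatibleRing R] [NonAssocRing S]
    [CompatibleRing S] (f : R →+* S) (t : Language.ring.Term α) (v : α → R) :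
    f (t.realize v) = t.realize (f ∘ v) := by
  induction t with
  | var a => rfl
  | func g ts ih =>
    simp only [Term.realize_func]
    cases g with
    | add => rw [CompatibleRing.funMap_add, CompatibleRing.funMap_add, map_add, ih 0, ih 1]
    | mul => rw [CompatibleRing.funMap_mul, CompatibleRing.funMap_mul, map_mul, ih 0, ih 1]
    | neg => rw [CompatibleRing.funMap_neg, CompatibleRing.funMap_neg, map_neg, ih 0]
    | zero =>
      have h1 := CompatibleRing.funMap_zero (R := R) fun i => (ts i).realize v
      have h2 := CompatibleRing.funMap_zero (R := S) fun i => (ts i).realize (f ∘ v)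
      simp only [Language.ring] at h1 h2 ⊢
      rw [h1, h2, map_zero]
    | one =>
      have h1 := CompatibleRing.funMap_one (R := R) fun i => (ts i).realize v
      have h2 := CompatibleRing.funMap_one (R := S) fun i => (ts i).realize (f ∘ v)
      simp only [Language.ring] at h1 h2 ⊢
      rw [h1, h2, map_one]

/-- A ring term is evaluated through its image in the free commutative ring:
`t(v) = lift v (t(of))`. [folklore] -/
theorem realize_term_eq_lift {R : Type*} [CommRing R] [CompatibleRing R]
    (t : Language.ring.Term α) (v : α → R) :
    t.realize v =
      FreeCommRing.lift v
        (letI := compatibleRingOfRing (FreeCommRing α); t.realize FreeCommRing.of) := by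
  letI := compatibleRingOfRing (FreeCommRing α)
  rw [map_realize_term]
  congr 1
  funext a
  simp

/-- **Ring terms are integer polynomials**: for a term `t` of the language of rings in variables
`α`, the polynomial `P_t := freeCommRingEquivMvPolynomialInt α (t(of)) ∈ ℤ[α]` satisfies
`t(v) = P_t(v)` in every commutative ring. [folklore] -/
theorem realize_term_eq_aeval {R : Type*} [CommRing R] [CompatibleRing R]
    (t : Language.ring.Term α) (v : α → R) :
    t.realize v = MvPolynomial.aeval v
      (freeCommRingEquivMvPolynomialInt α
        (letI := compatibleRingOfRing (FreeCommRing α); t.realize FreeCommRing.of)) := by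
  rw [realize_term_eq_lift]
  -- both sides are ring homomorphisms `FreeCommRing α → R` agreeing on the generators
  set p := (letI := compatibleRingOfRing (FreeCommRing α); t.realize FreeCommRing.of)
  change FreeCommRing.lift v p =
    ((MvPolynomial.aeval v).toRingHom.comp (freeCommRingEquivMvPolynomialInt α).toRingHom) p
  congr 1
  refine FreeCommRing.hom_ext fun a => ?_
  simp [freeCommRingEquivMvPolynomialInt]

/-- Atoms of ring formulas are polynomial equations: the atomic bounded formula `t₁ = t₂`
holds at `(v, xs)` iff the integer polynomial `P_{t₁} − P_{t₂}` vanishes at `(v, xs)`.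
[folklore] -/
theorem realize_bdEqual_iff_aeval_sub_eq_zero {R : Type*} [CommRing R] [CompatibleRing R]
    {l : ℕ} (t₁ t₂ : Language.ring.Term (α ⊕ Fin l)) (v : α → R) (xs : Fin l → R) :
    (t₁.bdEqual t₂).Realize v xs ↔
      MvPolynomial.aeval (Sum.elim v xs)
        (freeCommRingEquivMvPolynomialInt (α ⊕ Fin l)
            (letI := compatibleRingOfRing (FreeCommRing (α ⊕ Fin l)); t₁.realize FreeCommRing.of) -
          freeCommRingEquivMvPolynomialInt (α ⊕ Fin l)
            (letI := compatibleRingOfRing (FreeCommRing (α ⊕ Fin l)); t₂.realize FreeCommRing.of))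
        = 0 := by
  rw [BoundedFormula.realize_bdEqual, map_sub, sub_eq_zero, ← realize_term_eq_aeval,
    ← realize_term_eq_aeval]

/-- **Quantifier-free ring formulas are Boolean combinations of polynomial equations.** For a
quantifier-free bounded formula `φ` of the language of rings there are finitely many integer
polynomials `P₁, …, P_k` in its variables and a Boolean function `b` such that, in every
commutative ring, `φ` holds at `(v, xs)` iff `b` holds of the pattern `(P_j(v, xs) = 0)_j`; so the
set defined by `φ` is a Boolean combination of the algebraic sets `V(P_j)` (the input of CDM's
disjunctive-normal-form step in the proof of (3.5)). [folklore]
[cite: ChatzidakisVanDenDriesMacintyre1992, proof of (3.5)] -/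
theorem exists_mvPolynomial_boolean_of_isQF {l : ℕ} {φ : Language.ring.BoundedFormula α l}
    (hφ : φ.IsQF) :
    ∃ (k : ℕ) (P : Fin k → MvPolynomial (α ⊕ Fin l) ℤ) (b : (Fin k → Prop) → Prop),
      ∀ (R : Type*) [CommRing R] [CompatibleRing R] (v : α → R) (xs : Fin l → R),
        φ.Realize v xs ↔ b fun j => MvPolynomial.aeval (Sum.elim v xs) (P j) = 0 := by
  induction hφ with
  | falsum => exact ⟨0, Fin.elim0, fun _ => False, fun R _ _ v xs => Iff.rfl⟩
  | of_isAtomic h =>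
    cases h with
    | equal t₁ t₂ =>
      refine ⟨1, fun _ =>
        freeCommRingEquivMvPolynomialInt (α ⊕ Fin l)
            (letI := compatibleRingOfRing (FreeCommRing (α ⊕ Fin l)); t₁.realize FreeCommRing.of) -
          freeCommRingEquivMvPolynomialInt (α ⊕ Fin l)
            (letI := compatibleRingOfRing (FreeCommRing (α ⊕ Fin l)); t₂.realize FreeCommRing.of),
        fun z => z 0, fun R _ _ v xs => ?_⟩
      exact realize_bdEqual_iff_aeval_sub_eq_zero t₁ t₂ v xs
    | rel R ts => exact (R : Empty).elim
  | imp h₁ h₂ ih₁ ih₂ =>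
    obtain ⟨k₁, P₁, b₁, H₁⟩ := ih₁
    obtain ⟨k₂, P₂, b₂, H₂⟩ := ih₂
    refine ⟨k₁ + k₂, Fin.append P₁ P₂,
      fun z => b₁ (fun j => z (Fin.castAdd k₂ j)) → b₂ (fun j => z (Fin.natAdd k₁ j)),
      fun R _ _ v xs => ?_⟩
    simp only [BoundedFormula.realize_imp, H₁ R v xs, H₂ R v xs, Fin.append_left, Fin.append_right]

end TermsArePolynomials

end Literature.ModelTheory.PseudofiniteFields
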